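import Literature.IUT.HodgeTheaters.DiscreteProfiniteConjugatesRankTwo
import Mathlib.GroupTheory.Finiteness
import HarnessLib

/-!
# [IUTchI] Lemma 2.7 (ii)/(iii), free case, SPLIT forms (as consumed by the proofs of Thm 2.6 and Lem 2.7 (vi))

Mochizuki, *Inter-universal Teichmüller theory I*, kurims manuscript (May 2020), §2, pp. 56–59
[cite: Mochizuki2012, Lem 2.7 pp.57-59].  PROOF-ONLY; no new definitions.  The proof of
Theorem 2.6 (p. 57) uses Lemma 2.7 (ii)/(iii) in the SPLIT form "by replacing `G` by an appropriate
finite index subgroup of `G`, we may assume that the natural composite homomorphism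
`H_G ↪ G ↠ Gᵃᵇ` is a split injection" (l. 1–3) and "there exist elements `x, y ∈ H_G` that generate a
free abelian subgroup of rank two `M ⊆ Gᵃᵇ` such that the injection `M ↪ Gᵃᵇ` splits" (l. 13–15),
and the proof of Lemma 2.7 (vi) (p. 59) uses "a finite index subgroup `G₁ ⊆ G` equipped with a
surjection `β : G₁ ↠ ℤ × ℤ` and elements `x, y ∈ N ∩ G₁` such that `β(x) = (1, 0)` and
`β(y) = (0, 1)`".  For FREE `G` these split forms follow from the rank-two character
`exists_hom_closure_pair` (`DiscreteProfiniteConjugatesRankTwo.lean`) and M. Hall's theorem in the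
free-factor form (a finitely generated subgroup of a free group is a free factor of a subgroup of
finite index), which is taken here as the explicit hypothesis `hHall` in EXACTLY the shape of
`Literature.GroupTheory.CombinatorialGroupTheory.FreeFactor.exists_finiteIndex_freeFactor`
(abc-iut-L5-t16, staged; when it lands the hypothesis is discharged by that name):

* `exists_finiteIndex_split_pair` — `x, y` non-commuting ⇒ `∃` finite-index `K ∋ x, y` and
  `β : K → ℤ × ℤ` with `β x = (1, 0)`, `β y = (0, 1)`;
* `exists_finiteIndex_split_singleton` — `h ≠ 1` ⇒ `∃` finite-index `K ∋ h` and `β : K → ℤ` with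
  `β h = 1`.
-/

namespace Literature.IUT.HodgeTheaters

namespace FreeOrSurface

universe u

/-- **Split form of Lemma 2.7 (iii), free case** (as used on p. 57 l. 13–15 and p. 59): for
non-commuting `x, y` in a free group `G` — granted M. Hall's theorem in free-factor form `hHall` —
there are a finite index subgroup `K ∋ x, y` and a homomorphism `β : K → ℤ × ℤ` with `β(x) = (1, 0)`,
`β(y) = (0, 1)` (so `ℤ[x] ⊕ ℤ[y] ↪ Kᵃᵇ` splits). [cite: Mochizuki2012, Lem 2.7(iii) p.57] -/
theorem exists_finiteIndex_split_pair {G : Type u} [Group G] [IsFreeGroup G]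
    (hHall : ∀ H : Subgroup G, H.FG → ∃ K : Subgroup G, K.FiniteIndex ∧ H ≤ K ∧
      ∃ (κ : Type u) (s : Set κ) (bK : FreeGroupBasis (↥s ⊕ ↥sᶜ) K) (bH : FreeGroupBasis s H),
        (Finite (IsFreeGroup.Generators G) → Finite κ) ∧
          ∀ i : s, (bH i : G) = (bK (Sum.inl i) : G))
    {x y : G} (hxy : x * y ≠ y * x) :
    ∃ (K : Subgroup G) (hx : x ∈ K) (hy : y ∈ K), K.FiniteIndex ∧
      ∃ β : K →* Multiplicative ℤ × Multiplicative ℤ,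
        β ⟨x, hx⟩ = (Multiplicative.ofAdd 1, 1) ∧ β ⟨y, hy⟩ = (1, Multiplicative.ofAdd 1) := by
  classical
  set J := Subgroup.closure ({x, y} : Set G) with hJ
  have hxJ : x ∈ J := Subgroup.subset_closure (by simp)
  have hyJ : y ∈ J := Subgroup.subset_closure (by simp)
  obtain ⟨Ψ, hΨx, hΨy⟩ := exists_hom_closure_pair hxy
  let ΨJ : J →* Multiplicative ℤ × Multiplicative ℤ := Ψ
  have hΨJx : ΨJ ⟨x, hxJ⟩ = (Multiplicative.ofAdd 1, 1) := hΨx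
  have hΨJy : ΨJ ⟨y, hyJ⟩ = (1, Multiplicative.ofAdd 1) := hΨy
  have hJfg : J.FG := ⟨{x, y}, by simp [hJ]⟩
  obtain ⟨K, hKfi, hJK, κ, s, bK, bJ, -, hb⟩ := hHall J hJfg
  let f : ↥s ⊕ ↥sᶜ → Multiplicative ℤ × Multiplicative ℤ :=
    Sum.elim (fun i => ΨJ (bJ i)) (fun _ => 1)
  let β : K →* Multiplicative ℤ × Multiplicative ℤ := bK.lift f
  have hcomp : β.comp (Subgroup.inclusion hJK) = ΨJ := by
    refine bJ.ext_hom _ _ fun i => ?_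
    have e1 : Subgroup.inclusion hJK (bJ i) = bK (Sum.inl i) := Subtype.ext (hb i)
    rw [MonoidHom.comp_apply, e1]
    simp [β, f]
  refine ⟨K, hJK hxJ, hJK hyJ, hKfi, β, ?_, ?_⟩
  · have h1 := DFunLike.congr_fun hcomp ⟨x, hxJ⟩
    rw [MonoidHom.comp_apply, hΨJx] at h1
    exact h1
  · have h1 := DFunLike.congr_fun hcomp ⟨y, hyJ⟩
    rw [MonoidHom.comp_apply, hΨJy] at h1
    exact h1

/-- In a free group `FreeGroup s`, two distinct letters do not commute.
[cite: Mochizuki2012, Lem 2.7(iv) p.58] -/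
theorem freeGroup_of_mul_of_ne {s : Type u} {i j : s} (hij : i ≠ j) :
    FreeGroup.of i * FreeGroup.of j ≠ FreeGroup.of j * FreeGroup.of i := by
  classical
  let f : s → Equiv.Perm (Fin 3) := fun c => if c = i then Equiv.swap 0 1 else Equiv.swap 1 2
  intro h
  have h' := congrArg (FreeGroup.lift f) h
  simp only [map_mul, FreeGroup.lift_apply_of, f, if_neg (Ne.symm hij)] at h'
  exact absurd h' (by decide)

/-- **Split form of Lemma 2.7 (ii), free case** (as used on p. 57 l. 1–3: "we may assume that the
natural composite homomorphism `H_G ↪ G ↠ Gᵃᵇ` is a split injection", `H_G = ⟨h⟩`): for `h ≠ 1` in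
a free group `G` — granted M. Hall's theorem in free-factor form `hHall` — there are a finite index
subgroup `K ∋ h` and a homomorphism `β : K → ℤ` with `β(h) = 1`.
[cite: Mochizuki2012, Lem 2.7(ii) p.57] -/
theorem exists_finiteIndex_split_singleton {G : Type u} [Group G] [IsFreeGroup G]
    (hHall : ∀ H : Subgroup G, H.FG → ∃ K : Subgroup G, K.FiniteIndex ∧ H ≤ K ∧
      ∃ (κ : Type u) (s : Set κ) (bK : FreeGroupBasis (↥s ⊕ ↥sᶜ) K) (bH : FreeGroupBasis s H),
        (Finite (IsFreeGroup.Generators G) → Finite κ) ∧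
          ∀ i : s, (bH i : G) = (bK (Sum.inl i) : G))
    {h : G} (hh : h ≠ 1) :
    ∃ (K : Subgroup G) (hk : h ∈ K), K.FiniteIndex ∧
      ∃ β : K →* Multiplicative ℤ, β ⟨h, hk⟩ = Multiplicative.ofAdd 1 := by
  classical
  set H := Subgroup.zpowers h with hH
  have hhH : h ∈ H := Subgroup.mem_zpowers h
  have hHfg : H.FG := ⟨{h}, by simp [hH, Subgroup.zpowers_eq_closure]⟩
  obtain ⟨K, hKfi, hHK, κ, s, bK, bH, -, hb⟩ := hHall H hHfg
  set h' : H := ⟨h, hhH⟩ with hh'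
  have hh'1 : h' ≠ 1 := fun e => hh (by simpa [hh'] using congrArg Subtype.val e)
  -- the basis `s` of the infinite cyclic group `H` has exactly one element
  have hcomm : ∀ a b : H, a * b = b * a := by
    rintro ⟨a, ha⟩ ⟨b, hb⟩
    obtain ⟨m, rfl⟩ := Subgroup.mem_zpowers_iff.mp ha
    obtain ⟨n, rfl⟩ := Subgroup.mem_zpowers_iff.mp hb
    exact Subtype.ext (zpow_mul_comm h m n)
  have hsub : ∀ i j : s, i = j := by
    intro i j
    by_contra hij
    have h1 := hcomm (bH i) (bH j)
    have h2 := congrArg bH.repr h1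
    rw [map_mul, map_mul, bH.repr_apply_coe, bH.repr_apply_coe] at h2
    exact freeGroup_of_mul_of_ne hij h2
  obtain ⟨i₀⟩ : Nonempty s := by
    by_contra hs
    rw [not_nonempty_iff] at hs
    apply hh'1
    have htriv : ∀ w : FreeGroup s, w = 1 := fun w => by
      induction w using FreeGroup.induction_on with
      | C1 => rfl
      | of c => exact isEmptyElim c
      | inv_of c _ => exact isEmptyElim c
      | mul p q hp hq => rw [hp, hq, one_mul]
    exact bH.repr.injective (by rw [htriv (bH.repr h'), map_one])
  -- every element of `FreeGroup s` is a power of the letter `i₀`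
  have hpow : ∀ w : FreeGroup s, ∃ k : ℤ, w = FreeGroup.of i₀ ^ k := fun w => by
    induction w using FreeGroup.induction_on with
    | C1 => exact ⟨0, by simp⟩
    | of c => exact ⟨1, by rw [hsub c i₀, zpow_one]⟩
    | inv_of c _ => exact ⟨-1, by rw [hsub c i₀, zpow_neg, zpow_one]⟩
    | mul p q hp hq =>
      obtain ⟨a, rfl⟩ := hp
      obtain ⟨b, rfl⟩ := hq
      exact ⟨a + b, by rw [zpow_add]⟩
  -- `bH i₀ = h' ^ m` and `h' = (bH i₀) ^ k` with `k * m = 1`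
  obtain ⟨k, hk⟩ := hpow (bH.repr h')
  have hh'k : h' = bH i₀ ^ k := by
    apply bH.repr.injective
    rw [map_zpow, bH.repr_apply_coe, hk]
  obtain ⟨m, hm⟩ : ∃ m : ℤ, bH i₀ = h' ^ m := by
    have hmem : (bH i₀ : G) ∈ Subgroup.zpowers h := (bH i₀).2
    obtain ⟨m, hm⟩ := Subgroup.mem_zpowers_iff.mp hmem
    exact ⟨m, Subtype.ext (by simpa [hh'] using hm.symm)⟩
  have hkm : k * k = 1 := by
    -- evaluate the letter-counting character `FreeGroup s → ℤ` on `of i₀ = (of i₀) ^ (k * m)`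
    have e1 : (FreeGroup.of i₀ : FreeGroup s) = FreeGroup.of i₀ ^ (k * m) := by
      have e2 := congrArg bH.repr hm
      rw [bH.repr_apply_coe, map_zpow, hk, ← zpow_mul] at e2
      exact e2
    let χ : FreeGroup s →* Multiplicative ℤ := FreeGroup.lift fun _ => Multiplicative.ofAdd (1 : ℤ)
    have eL : Multiplicative.toAdd (χ (FreeGroup.of i₀)) = 1 := by simp [χ]
    have eR : Multiplicative.toAdd (χ (FreeGroup.of i₀ ^ (k * m))) = k * m := by
      simp [χ, toAdd_zpow]
    have e3 : (1 : ℤ) = k * m := by rw [← eL, ← eR, ← e1]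
    rcases Int.mul_eq_one_iff_eq_one_or_neg_one.mp e3.symm with ⟨hk1, -⟩ | ⟨hk1, -⟩ <;>
      simp [hk1]
  -- the character `β : K → ℤ`, `bK (inl i₀) ↦ k`, other letters `↦ 0`
  let f : ↥s ⊕ ↥sᶜ → Multiplicative ℤ := Sum.elim (fun _ => Multiplicative.ofAdd k) (fun _ => 1)
  let β : K →* Multiplicative ℤ := bK.lift f
  refine ⟨K, hHK hhH, hKfi, β, ?_⟩
  have e4 : (⟨h, hHK hhH⟩ : K) = Subgroup.inclusion hHK h' := rfl
  have e5 : Subgroup.inclusion hHK (bH i₀) = bK (Sum.inl i₀) := Subtype.ext (hb i₀)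
  have e6 : β (bK (Sum.inl i₀)) = Multiplicative.ofAdd k := by simp [β, f]
  rw [e4, hh'k, map_zpow, map_zpow, e5, e6]
  apply Multiplicative.toAdd.injective
  rw [toAdd_zpow, toAdd_ofAdd, toAdd_ofAdd, smul_eq_mul, hkm]

end FreeOrSurface

end Literature.IUT.HodgeTheaters
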